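import Mathlib
import HarnessLib
import Summits.AtomisticToContinuum.FouriersLaw.Theses.JunctionLocality
import Summits.AtomisticToContinuum.FouriersLaw.Theorems.JunctionLocalitySuperadditiveResistanceStubKappaFrame
import Summits.AtomisticToContinuum.FouriersLaw.Theorems.JunctionLocalitySuperadditiveResistanceStubPlainKuboLink
import Summits.AtomisticToContinuum.FouriersLaw.Theorems.JunctionLocalitySuperadditiveResistanceStubTerminationLocalityAux1
import Summits.AtomisticToContinuum.FouriersLaw.Theorems.JunctionLocalitySuperadditiveResistanceTerminationJunctionLift

/-!
# Termination locality in the κ-frame, helper V: the resolvent defect equation and the EXACT κ-frame identity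
(stub `stub_terminationLocality` (S1') of line `floating-probe-bypass-laplacian`, skeleton v7, crux
`JunctionLocality.SuperadditiveResistance`, stmt-AtomisticToContinuum-11748)

S1' compares, `N`-uniformly and eventually in `κ → 0⁺`, the self-conductance `K₀₀(κ) = γ − (γ²/T²)⟨g_0, p_0² − T⟩`
of bath `0` in the γ-probed `(N, M)`-device, read off a `κ`-RESOLVENT field `κ g_0 − L_dev g_0 = p_0² − T`
(`g_0 ∈ deviceResolventFields … 0 κ`), with the bare `N`-chain's `G_N = γ(1 − (γ/T²)⟨g_N, p_0² − T⟩)`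
(`g_N ∈ plainForwardFields … N`). This file proves, at FIXED `N, M, κ`:

* `deviceResolvent_defect` — the κ-frame defect equation: `u = g_0 − g_N ∘ π_N` solves, pointwise,
  `κ u − L_dev u = −κ g_N∘π_N + V'(q_N − q_{N−1}) · (∂_{p_{N−1}} g_N)∘π_N` (`V'(r) = r + βr³`; the source cancels because
  the probe at `N−1` IS the bare chain's right bath, landed `deviceGenerator_comp_restrictLeft`);
* `resolventDefect_pairing` — `⟨u, p_0² − T⟩_{μ^{(N+M)}} = Dyn_N(κ) − κ X_N(κ)` with
  `Dyn_N(κ) = ⟨g_0∘R, V'(r_J)(∂_{p_{N−1}} g_N)∘π_N⟩_{μ^{(N+M)}}` (`terminationDynamic`, `R` the momentum reversal) and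
  `X_N(κ) = ⟨g_0∘R, g_N∘π_N⟩_{μ^{(N+M)}}` (`terminationMass`): the landed cross Green identity `Kubo.cross` for the forward
  pair `u` (source `V'(r_J)(∂_{p_{N−1}}g_N)∘π_N − κ g_0`, in `L²` by the landed junction lift) against the backward pair
  `g_0∘R` (source `p_0² − T − κ g_0∘R`);
* `kuboMatrix_zero_zero_sub_plainKubo_resolvent` (registered as `helper_terminationResolventIdentity`) — **the exact
  κ-frame identity** `K₀₀(κ) − G_N = −(γ²/T²)(S_N + Dyn_N(κ)) + (γ²/T²) κ X_N(κ)`,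
  `S_N = ⟨g_N∘π_N, p_0²−T⟩_{μ^{(N+M)}} − ⟨g_N, p_0²−T⟩_{μ^{(N)}}` (`terminationStatic`, junction tilt of the left-block
  marginal), every term a Bochner integral of an integrable function (`integrable_termination*`).

Helper VI bounds the mass term by `O(√κ)` at fixed `N` and reduces the registered stub to the single `N`-uniform
inequality `−(γ²/T²)(S_N + Dyn_N(κ)) ≤ C₁ G_N²` (`TerminationRemainderBoundκ`). Skeleton vocabulary (same namespace);
block kinematics from `…StubTerminationLocalityAux1/4`. Fixed-`N` statements, standard axioms, no named fact used.
-/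

noncomputable section

open MeasureTheory Filter Topology
open scoped ContDiff
open Literature.MathematicalPhysics.KineticTheory.HeatConduction
open Summit.AtomisticToContinuum.FouriersLaw.Theorems.SuperadditiveResistance.DeviceLiouville
  (kin deviceGenerator deviceWeight deviceGenerator_eq kin_eq_sq liouvilleOp bathOp generator_eq_liouvilleOp_add)
open Summit.AtomisticToContinuum.FouriersLaw.Theorems.SuperadditiveResistance.Kubo
  (rev rev_apply contDiff_rev memLp_rev rev_pair cross memLp_partialP integrable_mul_mul_gibbsDensity)
open Summit.AtomisticToContinuum.FouriersLaw.Theorems.SuperadditiveResistance.TerminationLocality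
  (restrictLeft contDiff_restrictLeft contDiff_comp_restrictLeft kin_restrictLeft
    deviceGenerator_comp_restrictLeft deviceGenerator_sub memLp_comp_restrictLeft)
open Summit.AtomisticToContinuum.FouriersLaw.Cruxes.SuperadditiveResistance.ThermaliseThenCutProbeInsertion
  (memLp_junctionForce_mul_comp_restrictLeft)

namespace Summit.AtomisticToContinuum.FouriersLaw.Cruxes.SuperadditiveResistance.FloatingProbeBypassLaplacian

/-! ## The three functionals of the termination identity -/

/-- The FPU-β JUNCTION FORCE `V'(r_J) = r_J + β r_J³`, `r_J = q_N − q_{N−1}`, of the split `(N, M)` (`N, M ≥ 1`). -/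
def junctionForce (β : ℝ) {N M : ℕ} (hN : 1 ≤ N) (hM : 1 ≤ M) (x : PhaseSpace (N + M)) : ℝ :=
  (x.1 ⟨N, by omega⟩ - x.1 ⟨N - 1, by omega⟩) + β * (x.1 ⟨N, by omega⟩ - x.1 ⟨N - 1, by omega⟩) ^ 3

/-- The STATIC termination remainder `S_N = ⟨g_N∘π_N, p_0² − T⟩_{μ_T^{(N+M)}} − ⟨g_N, p_0² − T⟩_{μ_T^{(N)}}`:
the return pairing of a left-block field under the device's Gibbs state minus the same pairing under the bare
block's (the junction bond tilts the left-block marginal by a function of `q_{N−1}`). -/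
def terminationStatic (ω₂ lam β γ T : ℝ) (N M : ℕ) (gN : PhaseSpace N → ℝ) : ℝ :=
  (∫ x, gN (x.1 ∘ Fin.castAdd M, x.2 ∘ Fin.castAdd M) * (kin (N + M) 0 x - T)
      ∂((pinnedChain ω₂ lam β γ).gibbsMeasure (N + M) T)) -
    ∫ y, gN y * (kin N 0 y - T) ∂((pinnedChain ω₂ lam β γ).gibbsMeasure N T)

/-- The DYNAMIC termination remainder `Dyn_N = ⟨g_0∘R, V'(q_N − q_{N−1}) · (∂_{p_{N−1}} g_N)∘π_N⟩_{μ_T^{(N+M)}}`: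
the device field of bath `0`, momentum-reversed, paired with the junction force acting on the bare field's momentum
gradient at its γ-thermostatted end site (`N, M ≥ 1`). -/
def terminationDynamic (ω₂ lam β γ T : ℝ) {N M : ℕ} (hN : 1 ≤ N) (hM : 1 ≤ M)
    (g₀ : PhaseSpace (N + M) → ℝ) (gN : PhaseSpace N → ℝ) : ℝ :=
  ∫ x, g₀ (x.1, -x.2) * (junctionForce β hN hM x *
      partialP ⟨N - 1, by omega⟩ gN (x.1 ∘ Fin.castAdd M, x.2 ∘ Fin.castAdd M))
    ∂((pinnedChain ω₂ lam β γ).gibbsMeasure (N + M) T)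

/-- The MASS TERM `X_N = ⟨g_0∘R, g_N∘π_N⟩_{μ_T^{(N+M)}}` of the κ-frame identity (it enters with the factor `κ`). -/
def terminationMass (ω₂ lam β γ T : ℝ) (N M : ℕ) (g₀ : PhaseSpace (N + M) → ℝ) (gN : PhaseSpace N → ℝ) : ℝ :=
  ∫ x, g₀ (x.1, -x.2) * gN (x.1 ∘ Fin.castAdd M, x.2 ∘ Fin.castAdd M)
    ∂((pinnedChain ω₂ lam β γ).gibbsMeasure (N + M) T)

/-! ## Elementary facts -/

section Elementary

variable {N M : ℕ}

/-- `kin` is even in the momenta. -/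
theorem kin_neg_snd {L : ℕ} (s : ℕ) (x : PhaseSpace L) : kin L s (x.1, -x.2) = kin L s x := by simp [kin]

/-- The device's thermostat weights are non-negative. -/
theorem deviceWeight_nonneg' (N M : ℕ) (i : Fin (N + M)) : 0 ≤ deviceWeight N M i := by
  unfold deviceWeight OscillatorChain.bathWeight; split_ifs <;> norm_num

/-- The γ-thermostatted end site `N−1` of the bare `N`-chain carries a positive bath weight. -/
theorem bathWeight_last_pos (hN : 1 ≤ N) : 0 < OscillatorChain.bathWeight N ⟨N - 1, by omega⟩ := by
  unfold OscillatorChain.bathWeight; simp only; split_ifs <;> norm_num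

end Elementary

/-! ## The κ-frame defect equation -/

section Defect

variable {ω₂ lam β γ T : ℝ} {N M : ℕ}

/-- **The κ-frame defect equation (fixed `N`, exact).** Let `g_0 ∈ C²` solve the resolvent equation
`κ g_0 − L_dev g_0 = p_0² − T` of the `(N, M)`-device (all thermostats at `T`) and `g_N ∈ C²` the bare `N`-chain's
`L_N^{T,T} g_N = −(p_0² − T)` (`N, M ≥ 1`). Then `u := g_0 − g_N ∘ π_N` solves, pointwise,
`κ u − L_dev u = −κ · g_N∘π_N + V'(q_N − q_{N−1}) · (∂_{p_{N−1}} g_N)∘π_N`: the source cancels exactly (the probe at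
`N−1` reproduces the bare chain's right bath) and the defect is driven by the junction force on the bare field's
end-site momentum gradient plus the mass term `−κ g_N∘π_N`. -/
theorem deviceResolvent_defect (ω₂ lam β γ T κ : ℝ) (hN : 1 ≤ N) (hM : 1 ≤ M)
    {g₀ : PhaseSpace (N + M) → ℝ} {gN : PhaseSpace N → ℝ} (hg₀ : ContDiff ℝ 2 g₀) (hgN : ContDiff ℝ 2 gN)
    (hpde₀ : ∀ x, κ * g₀ x - deviceGenerator (pinnedChain ω₂ lam β γ) N M (fun _ => T) g₀ x =
      kin (N + M) 0 x - T)
    (hpdeN : ∀ y, (pinnedChain ω₂ lam β γ).generator N T T gN y = -(kin N 0 y - T))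
    (x : PhaseSpace (N + M)) :
    κ * (g₀ x - gN (restrictLeft N M x)) -
        deviceGenerator (pinnedChain ω₂ lam β γ) N M (fun _ => T) (fun y => g₀ y - gN (restrictLeft N M y)) x =
      -(κ * gN (restrictLeft N M x)) +
        junctionForce β hN hM x * partialP ⟨N - 1, by omega⟩ gN (restrictLeft N M x) := by
  have hcomp : ContDiff ℝ 2 (gN ∘ restrictLeft N M) := contDiff_comp_restrictLeft hgN
  have h1 := deviceGenerator_sub (pinnedChain ω₂ lam β γ) N M T hg₀ hcomp x
  have h2 := deviceGenerator_comp_restrictLeft ω₂ lam β γ T hN hM gN x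
  have h3 := hpdeN (restrictLeft N M x)
  rw [kin_restrictLeft (show 0 < N by omega)] at h3
  have h4 := hpde₀ x
  have e : (fun y => g₀ y - gN (restrictLeft N M y)) = fun y => g₀ y - (gN ∘ restrictLeft N M) y := rfl
  rw [e, h1, h2, h3]
  simp only [junctionForce]
  linarith

/-- The defect equation in PAIR FORM: `X_H u + γ S_B u = −(V'(r_J)(∂_{p_{N−1}} g_N)∘π_N − κ g_0)` with
`B = deviceWeight N M` (the form consumed by the landed Kubo toolkit). -/
theorem deviceResolvent_defect_pair (ω₂ lam β γ T κ : ℝ) (hN : 1 ≤ N) (hM : 1 ≤ M)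
    {g₀ : PhaseSpace (N + M) → ℝ} {gN : PhaseSpace N → ℝ} (hg₀ : ContDiff ℝ 2 g₀) (hgN : ContDiff ℝ 2 gN)
    (hpde₀ : ∀ x, κ * g₀ x - deviceGenerator (pinnedChain ω₂ lam β γ) N M (fun _ => T) g₀ x =
      kin (N + M) 0 x - T)
    (hpdeN : ∀ y, (pinnedChain ω₂ lam β γ).generator N T T gN y = -(kin N 0 y - T))
    (x : PhaseSpace (N + M)) :
    1 * liouvilleOp (pinnedChain ω₂ lam β γ) (N + M) (fun y => g₀ y - gN (restrictLeft N M y)) x +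
        γ * bathOp (N + M) (deviceWeight N M) T (fun y => g₀ y - gN (restrictLeft N M y)) x =
      -(junctionForce β hN hM x * partialP ⟨N - 1, by omega⟩ gN (restrictLeft N M x) - κ * g₀ x) := by
  have h := deviceResolvent_defect ω₂ lam β γ T κ hN hM hg₀ hgN hpde₀ hpdeN x
  rw [deviceGenerator_eq] at h
  have hγ' : (pinnedChain ω₂ lam β γ).γ = γ := rfl
  rw [hγ'] at h
  linarith

/-- A resolvent field of bath `0` in PAIR FORM: `X_H g_0 + γ S_B g_0 = −((p_0² − T) − κ g_0)`. -/
theorem deviceResolvent_pair (ω₂ lam β γ T κ : ℝ) {g₀ : PhaseSpace (N + M) → ℝ}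
    (hpde₀ : ∀ x, κ * g₀ x - deviceGenerator (pinnedChain ω₂ lam β γ) N M (fun _ => T) g₀ x =
      kin (N + M) 0 x - T)
    (x : PhaseSpace (N + M)) :
    1 * liouvilleOp (pinnedChain ω₂ lam β γ) (N + M) g₀ x + γ * bathOp (N + M) (deviceWeight N M) T g₀ x =
      -((kin (N + M) 0 x - T) - κ * g₀ x) := by
  have h := hpde₀ x
  rw [deviceGenerator_eq] at h
  have hγ' : (pinnedChain ω₂ lam β γ).γ = γ := rfl
  rw [hγ'] at h
  linarith

/-- Its momentum reversal is a BACKWARD pair: `−X_H (g_0∘R) + γ S_B (g_0∘R) = −((p_0² − T) − κ g_0∘R)`. -/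
theorem deviceResolvent_rev_pair (ω₂ lam β γ T κ : ℝ) {g₀ : PhaseSpace (N + M) → ℝ}
    (hpde₀ : ∀ x, κ * g₀ x - deviceGenerator (pinnedChain ω₂ lam β γ) N M (fun _ => T) g₀ x =
      kin (N + M) 0 x - T)
    (x : PhaseSpace (N + M)) :
    -1 * liouvilleOp (pinnedChain ω₂ lam β γ) (N + M) (rev g₀) x +
        γ * bathOp (N + M) (deviceWeight N M) T (rev g₀) x =
      -((kin (N + M) 0 x - T) - κ * rev g₀ x) := by
  have h := rev_pair (pinnedChain ω₂ lam β γ) (deviceWeight N M) T 1 γ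
    (k := fun y => (kin (N + M) 0 y - T) - κ * g₀ y) (deviceResolvent_pair ω₂ lam β γ T κ hpde₀) x
  rw [h, rev_apply, rev_apply, kin_neg_snd]

end Defect

/-! ## Square integrability of the players -/

section Integrability

variable {ω₂ lam β γ T : ℝ} {N M : ℕ}

/-- `p_s² − T ∈ L²(μ_T^{(L)})` in the `kin` form. -/
theorem memLp_kin_sub (hω : 0 < ω₂) (hl : 0 ≤ lam) (hβ : 0 ≤ β) (γ : ℝ) (L s : ℕ) (hT : 0 < T) :
    MemLp (fun x : PhaseSpace L => kin L s x - T) 2 ((pinnedChain ω₂ lam β γ).gibbsMeasure L T) := by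
  haveI := pinnedChain_isProbabilityMeasure_gibbsMeasure hω hl hβ γ L hT
  exact (pinnedChain_memLp_two_kin hω hl hβ γ L s hT).sub (memLp_const T)

/-- `∂_{p_{N−1}} g_N ∈ L²(μ_T^{(N)})` for a classical forward field of the bare `N`-chain (finite entropy
production at the γ-thermostatted end site; the landed energy estimate `Kubo.memLp_partialP`). -/
theorem memLp_partialP_plainField' (hω : 0 < ω₂) (hl : 0 ≤ lam) (hβ : 0 ≤ β) (hγ : 0 < γ) (hN : 1 ≤ N)
    (hT : 0 < T) {gN : PhaseSpace N → ℝ} (hgC : ContDiff ℝ 2 gN)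
    (hgL2 : MemLp gN 2 ((pinnedChain ω₂ lam β γ).gibbsMeasure N T))
    (hgpde : ∀ y, (pinnedChain ω₂ lam β γ).generator N T T gN y = -(kin N 0 y - T)) :
    MemLp (partialP ⟨N - 1, by omega⟩ gN) 2 ((pinnedChain ω₂ lam β γ).gibbsMeasure N T) := by
  have hpair : ∀ y, 1 * liouvilleOp (pinnedChain ω₂ lam β γ) N gN y +
      γ * bathOp N (OscillatorChain.bathWeight N) T gN y = -(kin N 0 y - T) := by
    intro y
    rw [← hgpde y, generator_eq_liouvilleOp_add]
    have : (pinnedChain ω₂ lam β γ).γ = γ := rfl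
    rw [this, one_mul]
  have hk : MemLp (fun y : PhaseSpace N => kin N 0 y - T) 2 ((pinnedChain ω₂ lam β γ).gibbsMeasure N T) :=
    memLp_kin_sub hω hl hβ γ N 0 hT
  have hB : ∀ i : Fin N, 0 ≤ OscillatorChain.bathWeight N i := fun i => by
    unfold OscillatorChain.bathWeight; split_ifs <;> norm_num
  exact memLp_partialP hω hl hβ γ N hT _ hB 1 hγ hgC hgL2 hk hpair (bathWeight_last_pos hN)

/-- The source of the defect equation is square integrable: `V'(r_J) · (∂_{p_{N−1}} g_N)∘π_N ∈ L²(μ_T^{(N+M)})`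
(the junction Boltzmann factor tames `V'`: landed `memLp_junctionForce_mul_comp_restrictLeft`). -/
theorem memLp_junctionSource (hω : 0 < ω₂) (hl : 0 ≤ lam) (hβ : 0 ≤ β) (hγ : 0 < γ) (hN : 1 ≤ N) (hM : 1 ≤ M)
    (hT : 0 < T) {gN : PhaseSpace N → ℝ} (hgC : ContDiff ℝ 2 gN)
    (hgL2 : MemLp gN 2 ((pinnedChain ω₂ lam β γ).gibbsMeasure N T))
    (hgpde : ∀ y, (pinnedChain ω₂ lam β γ).generator N T T gN y = -(kin N 0 y - T)) :
    MemLp (fun x : PhaseSpace (N + M) => junctionForce β hN hM x *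
        partialP ⟨N - 1, by omega⟩ gN (x.1 ∘ Fin.castAdd M, x.2 ∘ Fin.castAdd M)) 2
      ((pinnedChain ω₂ lam β γ).gibbsMeasure (N + M) T) := by
  have hdgN := memLp_partialP_plainField' hω hl hβ hγ hN hT hgC hgL2 hgpde
  have hc : Continuous (partialP ⟨N - 1, by omega⟩ gN) :=
    continuous_partialP (hgC.of_le (by norm_cast) : ContDiff ℝ 1 gN) one_ne_zero _
  exact memLp_junctionForce_mul_comp_restrictLeft hω hl hβ γ hN hM hT hc hdgN

/-- The integrand of `Dyn_N` is integrable (`g_0, g_N` square integrable, `g_N` a classical plain forward field). -/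
theorem integrable_terminationDynamic (hω : 0 < ω₂) (hl : 0 ≤ lam) (hβ : 0 ≤ β) (hγ : 0 < γ) (hN : 1 ≤ N)
    (hM : 1 ≤ M) (hT : 0 < T) {g₀ : PhaseSpace (N + M) → ℝ} (hg₀C : ContDiff ℝ 2 g₀)
    (hg₀L : MemLp g₀ 2 ((pinnedChain ω₂ lam β γ).gibbsMeasure (N + M) T))
    {gN : PhaseSpace N → ℝ} (hgC : ContDiff ℝ 2 gN) (hgL2 : MemLp gN 2 ((pinnedChain ω₂ lam β γ).gibbsMeasure N T))
    (hgpde : ∀ y, (pinnedChain ω₂ lam β γ).generator N T T gN y = -(kin N 0 y - T)) :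
    Integrable (fun x : PhaseSpace (N + M) => g₀ (x.1, -x.2) * (junctionForce β hN hM x *
        partialP ⟨N - 1, by omega⟩ gN (x.1 ∘ Fin.castAdd M, x.2 ∘ Fin.castAdd M)))
      ((pinnedChain ω₂ lam β γ).gibbsMeasure (N + M) T) :=
  (memLp_rev hω hl hβ (N + M) hT hg₀C.continuous hg₀L).integrable_mul
    (memLp_junctionSource hω hl hβ hγ hN hM hT hgC hgL2 hgpde)

/-- The integrand of `X_N` is integrable. -/
theorem integrable_terminationMass (hω : 0 < ω₂) (hl : 0 ≤ lam) (hβ : 0 ≤ β) (hN : 1 ≤ N) (hM : 1 ≤ M)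
    (hT : 0 < T) {g₀ : PhaseSpace (N + M) → ℝ} (hg₀C : ContDiff ℝ 2 g₀)
    (hg₀L : MemLp g₀ 2 ((pinnedChain ω₂ lam β γ).gibbsMeasure (N + M) T))
    {gN : PhaseSpace N → ℝ} (hgL2 : MemLp gN 2 ((pinnedChain ω₂ lam β γ).gibbsMeasure N T)) :
    Integrable (fun x : PhaseSpace (N + M) => g₀ (x.1, -x.2) * gN (x.1 ∘ Fin.castAdd M, x.2 ∘ Fin.castAdd M))
      ((pinnedChain ω₂ lam β γ).gibbsMeasure (N + M) T) :=
  (memLp_rev hω hl hβ (N + M) hT hg₀C.continuous hg₀L).integrable_mul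
    (memLp_comp_restrictLeft hω hl hβ γ hN hM hT hgL2)

/-- Both integrands of `S_N` are integrable. -/
theorem integrable_terminationStatic (hω : 0 < ω₂) (hl : 0 ≤ lam) (hβ : 0 ≤ β) (hN : 1 ≤ N) (hM : 1 ≤ M)
    (hT : 0 < T) {gN : PhaseSpace N → ℝ} (hgL2 : MemLp gN 2 ((pinnedChain ω₂ lam β γ).gibbsMeasure N T)) :
    Integrable (fun x : PhaseSpace (N + M) => gN (x.1 ∘ Fin.castAdd M, x.2 ∘ Fin.castAdd M) * (kin (N + M) 0 x - T))
        ((pinnedChain ω₂ lam β γ).gibbsMeasure (N + M) T) ∧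
      Integrable (fun y : PhaseSpace N => gN y * (kin N 0 y - T)) ((pinnedChain ω₂ lam β γ).gibbsMeasure N T) :=
  ⟨(memLp_comp_restrictLeft hω hl hβ γ hN hM hT hgL2).integrable_mul (memLp_kin_sub hω hl hβ γ (N + M) 0 hT),
    hgL2.integrable_mul (memLp_kin_sub hω hl hβ γ N 0 hT)⟩

end Integrability

/-! ## The Green pairing across the junction, with the mass term -/

section Pairing

variable {ω₂ lam β γ T : ℝ} {N M : ℕ}

/-- **The κ-frame Green pairing across the junction (fixed `N`, `M`, `κ`; exact).** For a classical `κ`-resolvent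
field `g_0 ∈ C² ∩ L²(μ_T^{(N+M)})` of bath `0` of the `(N, M)`-device and a classical forward field
`g_N ∈ C² ∩ L²(μ_T^{(N)})` of the bare `N`-chain's left bath, the defect `u = g_0 − g_N∘π_N` has return pairing
`⟨u, p_0² − T⟩_{μ^{(N+M)}} = Dyn_N − κ X_N`: the landed cross Green identity for the forward pair
`(u, V'(r_J)(∂_{p_{N−1}}g_N)∘π_N − κ g_0)` against the backward pair `(g_0∘R, (p_0² − T) − κ g_0∘R)`. -/
theorem resolventDefect_pairing (hω : 0 < ω₂) (hl : 0 ≤ lam) (hβ : 0 ≤ β) (hγ : 0 < γ) (hN : 1 ≤ N) (hM : 1 ≤ M)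
    (hT : 0 < T) (κ : ℝ) {g₀ : PhaseSpace (N + M) → ℝ} (hg₀C : ContDiff ℝ 2 g₀)
    (hg₀L : MemLp g₀ 2 ((pinnedChain ω₂ lam β γ).gibbsMeasure (N + M) T))
    (hpde₀ : ∀ x, κ * g₀ x - deviceGenerator (pinnedChain ω₂ lam β γ) N M (fun _ => T) g₀ x =
      kin (N + M) 0 x - T)
    {gN : PhaseSpace N → ℝ} (hgC : ContDiff ℝ 2 gN) (hgL2 : MemLp gN 2 ((pinnedChain ω₂ lam β γ).gibbsMeasure N T))
    (hgpde : ∀ y, (pinnedChain ω₂ lam β γ).generator N T T gN y = -(kin N 0 y - T)) :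
    ∫ x, (g₀ x - gN (x.1 ∘ Fin.castAdd M, x.2 ∘ Fin.castAdd M)) * (kin (N + M) 0 x - T)
        ∂((pinnedChain ω₂ lam β γ).gibbsMeasure (N + M) T) =
      terminationDynamic ω₂ lam β γ T hN hM g₀ gN - κ * terminationMass ω₂ lam β γ T N M g₀ gN := by
  set P := pinnedChain ω₂ lam β γ with hP
  set μ := P.gibbsMeasure (N + M) T with hμ
  -- the players
  set u : PhaseSpace (N + M) → ℝ := fun y => g₀ y - gN (restrictLeft N M y) with hu
  set J : PhaseSpace (N + M) → ℝ := fun x => junctionForce β hN hM x *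
    partialP ⟨N - 1, by omega⟩ gN (restrictLeft N M x) with hJ
  set k₀ : PhaseSpace (N + M) → ℝ := fun x => kin (N + M) 0 x - T with hk₀
  set gNπ : PhaseSpace (N + M) → ℝ := fun x => gN (restrictLeft N M x) with hgNπ
  -- regularity
  have hgNπC : ContDiff ℝ 2 gNπ := contDiff_comp_restrictLeft hgC
  have hgNπL : MemLp gNπ 2 μ := memLp_comp_restrictLeft hω hl hβ γ hN hM hT hgL2
  have huC : ContDiff ℝ 2 u := hg₀C.sub hgNπC
  have huL : MemLp u 2 μ := hg₀L.sub hgNπL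
  have hrevC : ContDiff ℝ 2 (rev g₀) := contDiff_rev hg₀C
  have hrevL : MemLp (rev g₀) 2 μ := memLp_rev hω hl hβ (N + M) hT hg₀C.continuous hg₀L
  have hJL : MemLp J 2 μ := memLp_junctionSource hω hl hβ hγ hN hM hT hgC hgL2 hgpde
  have hk₀L : MemLp k₀ 2 μ := memLp_kin_sub hω hl hβ γ (N + M) 0 hT
  have hkfL : MemLp (fun x => J x - κ * g₀ x) 2 μ := hJL.sub (hg₀L.const_mul κ)
  have hkhL : MemLp (fun x => k₀ x - κ * rev g₀ x) 2 μ := hk₀L.sub (hrevL.const_mul κ)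
  -- the two pairs
  have hpair_u : ∀ x, 1 * liouvilleOp P (N + M) u x + γ * bathOp (N + M) (deviceWeight N M) T u x =
      -(J x - κ * g₀ x) := fun x =>
    deviceResolvent_defect_pair ω₂ lam β γ T κ hN hM hg₀C hgC hpde₀ hgpde x
  have hpair_rev : ∀ x, -1 * liouvilleOp P (N + M) (rev g₀) x + γ * bathOp (N + M) (deviceWeight N M) T (rev g₀) x =
      -(k₀ x - κ * rev g₀ x) := fun x => deviceResolvent_rev_pair ω₂ lam β γ T κ hpde₀ x
  -- the cross Green identity (density form)
  have hcross := cross hω hl hβ (N + M) hT (deviceWeight N M) (deviceWeight_nonneg' N M) 1 hγ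
    huC hrevC huL hrevL hkfL hkhL hpair_u hpair_rev
  -- expand both sides
  set ρ := P.gibbsDensity (N + M) T with hρ
  have hI1 := integrable_mul_mul_gibbsDensity hω hl hβ γ (N + M) hT hrevL hJL
  have hI2 := integrable_mul_mul_gibbsDensity hω hl hβ γ (N + M) hT hrevL hg₀L
  have hI3 := integrable_mul_mul_gibbsDensity hω hl hβ γ (N + M) hT huL hk₀L
  have hI4 := integrable_mul_mul_gibbsDensity hω hl hβ γ (N + M) hT huL hrevL
  have hI5 := integrable_mul_mul_gibbsDensity hω hl hβ γ (N + M) hT hrevL hgNπL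
  have eL : ∫ x, rev g₀ x * (J x - κ * g₀ x) * ρ x =
      (∫ x, rev g₀ x * J x * ρ x) - κ * ∫ x, rev g₀ x * g₀ x * ρ x := by
    rw [← integral_const_mul, ← integral_sub hI1 (hI2.const_mul κ)]
    exact integral_congr_ae (ae_of_all _ fun x => by ring)
  have eR : ∫ x, u x * (k₀ x - κ * rev g₀ x) * ρ x =
      (∫ x, u x * k₀ x * ρ x) - κ * ∫ x, u x * rev g₀ x * ρ x := by
    rw [← integral_const_mul, ← integral_sub hI3 (hI4.const_mul κ)]
    exact integral_congr_ae (ae_of_all _ fun x => by ring)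
  have eU : ∫ x, u x * rev g₀ x * ρ x = (∫ x, rev g₀ x * g₀ x * ρ x) - ∫ x, rev g₀ x * gNπ x * ρ x := by
    rw [← integral_sub hI2 hI5]
    exact integral_congr_ae (ae_of_all _ fun x => by simp only [hu]; ring)
  rw [eL, eR, eU] at hcross
  have key : ∫ x, u x * k₀ x * ρ x = (∫ x, rev g₀ x * J x * ρ x) - κ * ∫ x, rev g₀ x * gNπ x * ρ x := by linarith
  -- back to the Gibbs measure
  simp only [terminationDynamic, terminationMass]
  rw [P.integral_gibbsMeasure, P.integral_gibbsMeasure, P.integral_gibbsMeasure]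
  have e1 : ∫ x, (g₀ x - gN (x.1 ∘ Fin.castAdd M, x.2 ∘ Fin.castAdd M)) * (kin (N + M) 0 x - T) * ρ x =
      ∫ x, u x * k₀ x * ρ x := rfl
  have e2 : ∫ x, g₀ (x.1, -x.2) * (junctionForce β hN hM x *
      partialP ⟨N - 1, by omega⟩ gN (x.1 ∘ Fin.castAdd M, x.2 ∘ Fin.castAdd M)) * ρ x =
      ∫ x, rev g₀ x * J x * ρ x := rfl
  have e3 : ∫ x, g₀ (x.1, -x.2) * gN (x.1 ∘ Fin.castAdd M, x.2 ∘ Fin.castAdd M) * ρ x =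
      ∫ x, rev g₀ x * gNπ x * ρ x := rfl
  rw [e1, e2, e3, key]
  ring

end Pairing

/-! ## The exact κ-frame termination identity -/

section Identity

variable {ω₂ lam β γ T : ℝ} {N M : ℕ}

/-- `K₀₀ = γ − (γ²/T²)⟨g_0, p_0² − T⟩` (unfolding the skeleton's `kuboMatrix` at `(0, 0)`). -/
theorem kuboMatrix_zero_zero_eq (ω₂ lam β γ T : ℝ) (N M : ℕ) (g : Fin 4 → PhaseSpace (N + M) → ℝ) :
    kuboMatrix ω₂ lam β γ T N M g 0 0 = γ - γ ^ 2 / T ^ 2 *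
      ∫ x, g 0 x * (kin (N + M) 0 x - T) ∂((pinnedChain ω₂ lam β γ).gibbsMeasure (N + M) T) := by
  simp [kuboMatrix, termSite_zero]

/-- **THE EXACT κ-FRAME TERMINATION IDENTITY (left block; fixed `N`, `M`, `κ`).** For the pinned chain
(`ω₂ > 0`, `lam, β ≥ 0`, `γ, T > 0`, `N, M ≥ 1`), any family `g` whose bath-`0` member is a `κ`-resolvent field of the
device and any plain forward field `g_N` of the bare `N`-chain:

  `K₀₀(κ) − G_N = −(γ²/T²)·(S_N + Dyn_N(κ)) + (γ²/T²)·κ·X_N(κ)`,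

`S_N = terminationStatic` (junction tilt of the left-block marginal), `Dyn_N(κ) = terminationDynamic … (g 0) g_N`
(device field reversed × junction force × end-site momentum gradient of the bare field), `X_N(κ) = terminationMass`
(`κ X_N = O(√κ)` at fixed `N`, helper VI). For a member of the skeleton's resolvent family use `hg 0`
(`termSite N M 0 = 0` definitionally). -/
theorem kuboMatrix_zero_zero_sub_plainKubo_resolvent (hω : 0 < ω₂) (hl : 0 ≤ lam) (hβ : 0 ≤ β) (hγ : 0 < γ)
    (hN : 1 ≤ N) (hM : 1 ≤ M) (hT : 0 < T) (κ : ℝ) (g : Fin 4 → PhaseSpace (N + M) → ℝ) (gN : PhaseSpace N → ℝ)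
    (hg₀ : g 0 ∈ deviceResolventFields ω₂ lam β γ T N M 0 κ) (hgN : gN ∈ plainForwardFields ω₂ lam β γ T N) :
    kuboMatrix ω₂ lam β γ T N M g 0 0 - plainKubo ω₂ lam β γ T N gN =
      -(γ ^ 2 / T ^ 2) * (terminationStatic ω₂ lam β γ T N M gN + terminationDynamic ω₂ lam β γ T hN hM (g 0) gN) +
        γ ^ 2 / T ^ 2 * κ * terminationMass ω₂ lam β γ T N M (g 0) gN := by
  obtain ⟨hg₀C, hg₀L, hpde₀⟩ := hg₀
  obtain ⟨hgC, hgL2, -, hgpde⟩ := hgN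
  have hD := resolventDefect_pairing hω hl hβ hγ hN hM hT κ hg₀C hg₀L hpde₀ hgC hgL2 hgpde
  obtain ⟨hI2, -⟩ := integrable_terminationStatic hω hl hβ hN hM hT (γ := γ) hgL2
  have hk₀L : MemLp (fun x : PhaseSpace (N + M) => kin (N + M) 0 x - T) 2
      ((pinnedChain ω₂ lam β γ).gibbsMeasure (N + M) T) := memLp_kin_sub hω hl hβ γ (N + M) 0 hT
  have hgNπL := memLp_comp_restrictLeft hω hl hβ γ hN hM hT hgL2
  have hI1 : Integrable (fun x => (g 0 x - gN (x.1 ∘ Fin.castAdd M, x.2 ∘ Fin.castAdd M)) *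
      (kin (N + M) 0 x - T)) ((pinnedChain ω₂ lam β γ).gibbsMeasure (N + M) T) :=
    (hg₀L.sub hgNπL).integrable_mul hk₀L
  have hsplit : ∫ x, g 0 x * (kin (N + M) 0 x - T) ∂((pinnedChain ω₂ lam β γ).gibbsMeasure (N + M) T) =
      (∫ x, (g 0 x - gN (x.1 ∘ Fin.castAdd M, x.2 ∘ Fin.castAdd M)) * (kin (N + M) 0 x - T)
        ∂((pinnedChain ω₂ lam β γ).gibbsMeasure (N + M) T)) +
        ∫ x, gN (x.1 ∘ Fin.castAdd M, x.2 ∘ Fin.castAdd M) * (kin (N + M) 0 x - T)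
          ∂((pinnedChain ω₂ lam β γ).gibbsMeasure (N + M) T) := by
    rw [← integral_add hI1 hI2]
    exact integral_congr_ae (ae_of_all _ fun x => by ring)
  rw [kuboMatrix_zero_zero_eq, plainKubo, hsplit, hD, terminationStatic]
  ring

/-- Registered helper sub-goal `helper_terminationResolventIdentity` (= `kuboMatrix_zero_zero_sub_plainKubo_resolvent`
in stub form, the three functionals written out). -/
theorem helper_terminationResolventIdentity : ∀ (ω₂ lam β γ T : ℝ), 0 < ω₂ → 0 ≤ lam → 0 ≤ β → 0 < γ → 0 < T → ∀ (N M : ℕ) (hN : 1 ≤ N) (hM : 1 ≤ M) (κ : ℝ) (g : Fin 4 → PhaseSpace (N + M) → ℝ) (gN : PhaseSpace N → ℝ), g 0 ∈ deviceResolventFields ω₂ lam β γ T N M 0 κ → gN ∈ plainForwardFields ω₂ lam β γ T N → kuboMatrix ω₂ lam β γ T N M g 0 0 - plainKubo ω₂ lam β γ T N gN = -(γ ^ 2 / T ^ 2) * (((∫ x, gN (x.1 ∘ Fin.castAdd M, x.2 ∘ Fin.castAdd M) * (kin (N + M) 0 x - T) ∂((pinnedChain ω₂ lam β γ).gibbsMeasure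 (N + M) T)) - ∫ y, gN y * (kin N 0 y - T) ∂((pinnedChain ω₂ lam β γ).gibbsMeasure N T)) + ∫ x, g 0 (x.1, -x.2) * (((x.1 ⟨N, by omega⟩ - x.1 ⟨N - 1, by omega⟩) + β * (x.1 ⟨N, by omega⟩ - x.1 ⟨N - 1, by omega⟩) ^ 3) * partialP ⟨N - 1, by omega⟩ gN (x.1 ∘ Fin.castAdd M, x.2 ∘ Fin.castAdd M)) ∂((pinnedChain ω₂ lam β γ).gibbsMeasure (N + M) T)) + γ ^ 2 / T ^ 2 * κ * ∫ x, g 0 (x.1, -x.2) * gN (x.1 ∘ Fin.castAdd M, x.2 ∘ Fin.castAdd M) ∂((pinnedChain ω₂ lam β γ).gibbsMeasure (N + M) T) :=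
  fun _ _ _ _ _ hω hl hβ hγ hT _ _ hN hM κ g gN hg₀ hgN =>
    kuboMatrix_zero_zero_sub_plainKubo_resolvent hω hl hβ hγ hN hM hT κ g gN hg₀ hgN

end Identity

end Summit.AtomisticToContinuum.FouriersLaw.Cruxes.SuperadditiveResistance.FloatingProbeBypassLaplacian

end
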